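import Summits.FinalStateConjecture.FinalStateConjecture.Theorems.ClusterCompletenessOmegaLimitMultiKerrUniformRecurrence
import HarnessLib

/-!
# Route ClusterCompleteness · crux `OmegaLimitMultiKerr` — jointly uniformly recurrent dark limits
# of two systems (one chart time for all holes)

Structure lemma for the crux stmt-FinalStateConjecture-14664
(`ClusterCompleteness.OmegaLimitMultiKerr`), line `Sketch` (registered stub
`exists_joint_omegaLimit_uniformlyRecurrent`, closed form).

The one-system theorem `exists_omegaLimit_uniformlyRecurrent` (`…UniformRecurrence`) produces, for
a tame `C^{k+1}` field `h` on an open `e`-invariant domain `O`, a `Cᵏ_loc` ω-limit which is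
uniformly recurrent under the translation `x ↦ x + s • e`. The crux reads `N` hole charts with ONE
chart-time parameter, and its recurrence clause asks ALL holes to return along ONE sequence of
times. This file proves the two-system case (induction then gives `Fin N`): for tame fields
`h₁ : E₁ → W₁` on `O₁` (translation `e₁`) and `h₂ : E₂ → W₂` on `O₂` (translation `e₂`) there
are ω-limits `g₁, g₂` along a COMMON sequence `Tₙ → +∞` which are JOINTLY uniformly recurrent:
every interval `[t, t + L]` contains a common `ε`-return time `s` of `g₁` on `K₁` and `g₂` on `K₂`.

Proof. Apply the one-system theorem to the PRODUCT field `H (x, y) = (h₁ x, h₂ y)` on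
`O₁ ×ˢ O₂` with translation `(e₁, e₂)` (it is `C^{k+1}` and tame: the iterated derivatives of
`H` are the products of those of `h₁ ∘ fst` and `h₂ ∘ snd`, of norm `≤ max`), get a uniformly
recurrent ω-limit `G`. Pointwise limits show `G (x, y) = (g₁ x, g₂ y)` is of product form on
`O₁ ×ˢ O₂`; the `Cᵏ` sup norms of the components over `K₁`, `K₂` are dominated by those of the
product field over the slices `K₁ ×ˢ {y₀}`, `{x₀} ×ˢ K₂` (chain rule with the isometric
embeddings `inl`, `inr` and the projections `fst`, `snd`, all of operator norm `≤ 1`), so the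
convergence and the return times of `G` on `K₁ ×ˢ {y₀} ∪ {x₀} ×ˢ K₂` serve both components.
Sources: Birkhoff, *Dynamical Systems* (1927), Ch. VII §§1–2; Hale 1980, Ch. I §8 (almost
periodicity is preserved under products of flows). Mathlib + landed `Theorems` files only.
-/

-- every `Summit.FinalStateConjecture.FinalStateConjecture.…` name repeats the summit = sub-problem segment (D-0017 layout)
set_option linter.dupNamespace false

noncomputable section

open Set Filter Topology Function
open scoped ContDiff Topology ENNReal

namespace Summit.FinalStateConjecture.FinalStateConjecture.Theorems.ClusterCompleteness

open Literature.Geometry.Lorentzian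

/-! ### Chain-rule bounds: slices and components of fields on products -/

section Slices

variable {V E F F' : Type*} [NormedAddCommGroup V] [NormedSpace ℝ V] [NormedAddCommGroup E]
  [NormedSpace ℝ E] [NormedAddCommGroup F] [NormedSpace ℝ F] [NormedAddCommGroup F']
  [NormedSpace ℝ F']

/-- **Local chain rule bound.** For `u` of class `Cⁿ` on an open set `O`, continuous linear maps
`A`, `B` of operator norm `≤ 1` and a shift `c`, the derivatives of order `m ≤ n` of
`w ↦ B (u (A w + c))` at `v` are bounded in norm by those of `u` at `A v + c ∈ O`
(`D^m (B ∘ u ∘ (A · + c)) = B ∘ D^m u ∘ (A, …, A)`). [folklore] -/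
private theorem norm_iteratedFDeriv_clm_comp_comp_affine_le {O : Set E} (hO : IsOpen O) {n : ℕ}
    {u : E → F} (hu : ContDiffOn ℝ n u O) (A : V →L[ℝ] E) (c : E) (B : F →L[ℝ] F')
    (hA : ‖A‖ ≤ 1) (hB : ‖B‖ ≤ 1) {v : V} (hv : A v + c ∈ O) {m : ℕ} (hm : m ≤ n) :
    ‖iteratedFDeriv ℝ m (fun w ↦ B (u (A w + c))) v‖ ≤ ‖iteratedFDeriv ℝ m u (A v + c)‖ := by
  have hm' : (m : WithTop ℕ∞) ≤ n := by exact_mod_cast hm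
  -- the shifted field `u (· + c)` is `Cⁿ` on the open preimage of `O`
  have hO' : IsOpen ((fun z ↦ z + c) ⁻¹' O) := hO.preimage (continuous_id.add continuous_const)
  have hf : ContDiffOn ℝ n (fun z ↦ u (z + c)) ((fun z ↦ z + c) ⁻¹' O) :=
    hu.comp (contDiffOn_id.add contDiffOn_const) fun z hz ↦ hz
  have hAv : A v ∈ (fun z ↦ z + c) ⁻¹' O := hv
  have hOA : IsOpen (A ⁻¹' ((fun z ↦ z + c) ⁻¹' O)) := hO'.preimage A.continuous
  have hvA : v ∈ A ⁻¹' ((fun z ↦ z + c) ⁻¹' O) := hv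
  -- right composition with `A`, then the translation by `c`
  have h1 : iteratedFDeriv ℝ m ((fun z ↦ u (z + c)) ∘ A) v =
      (iteratedFDeriv ℝ m u (A v + c)).compContinuousLinearMap fun _ ↦ A := by
    rw [← iteratedFDerivWithin_of_isOpen (f := (fun z ↦ u (z + c)) ∘ A) m hOA hvA,
      A.iteratedFDerivWithin_comp_right hf hO'.uniqueDiffOn hOA.uniqueDiffOn hAv hm',
      iteratedFDerivWithin_of_isOpen (f := fun z ↦ u (z + c)) m hO' hAv,
      iteratedFDeriv_comp_add_right (f := u) m c (A v)]
  -- left composition with `B`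
  have hfA : ContDiffAt ℝ n ((fun z ↦ u (z + c)) ∘ A) v :=
    (hf.contDiffAt (hO'.mem_nhds hAv)).comp v A.contDiff.contDiffAt
  have h2 : iteratedFDeriv ℝ m (fun w ↦ B (u (A w + c))) v =
      B.compContinuousMultilinearMap (iteratedFDeriv ℝ m ((fun z ↦ u (z + c)) ∘ A) v) :=
    B.iteratedFDeriv_comp_left hfA hm'
  rw [h2, h1]
  refine (B.norm_compContinuousMultilinearMap_le _).trans ?_
  refine (mul_le_mul hB (ContinuousMultilinearMap.norm_compContinuousLinearMap_le _ _)
    (norm_nonneg _) zero_le_one).trans ?_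
  rw [one_mul]
  refine (mul_le_mul_of_nonneg_left (Finset.prod_le_one (fun _ _ ↦ norm_nonneg _)
    fun _ _ ↦ hA) (norm_nonneg _)).trans_eq (mul_one _)

/-- **`Cᵏ` sup norm form of the local chain rule bound**: if `A v + c ∈ S ⊆ O` for all `v ∈ K`,
then `‖B ∘ u ∘ (A · + c)‖_{Cᵏ(K)} ≤ ‖u‖_{Cᵏ(S)}`. [folklore] -/
private theorem supCkENorm_clm_comp_comp_affine_le {O : Set E} (hO : IsOpen O) {k : ℕ}
    {u : E → F} (hu : ContDiffOn ℝ k u O) (A : V →L[ℝ] E) (c : E) (B : F →L[ℝ] F')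
    (hA : ‖A‖ ≤ 1) (hB : ‖B‖ ≤ 1) {K : Set V} {S : Set E} (hKS : ∀ v ∈ K, A v + c ∈ S)
    (hSO : S ⊆ O) : supCkENorm K k (fun w ↦ B (u (A w + c))) ≤ supCkENorm S k u := by
  refine supCkENorm_le_of_forall_le fun m hm v hv ↦ ?_
  refine le_trans ?_ (enorm_iteratedFDeriv_le_supCkENorm hm (hKS v hv) u)
  rw [← ofReal_norm, ← ofReal_norm]
  exact ENNReal.ofReal_le_ofReal
    (norm_iteratedFDeriv_clm_comp_comp_affine_le hO hu A c B hA hB (hSO (hKS v hv)) hm)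

end Slices

section TwoSystems

variable {E₁ : Type*} [NormedAddCommGroup E₁] [NormedSpace ℝ E₁]
  {E₂ : Type*} [NormedAddCommGroup E₂] [NormedSpace ℝ E₂]
  {W₁ : Type*} [NormedAddCommGroup W₁] [NormedSpace ℝ W₁]
  {W₂ : Type*} [NormedAddCommGroup W₂] [NormedSpace ℝ W₂]

/-- **Derivatives of a product field.** For `h₁`, `h₂` of class `Cⁿ` on open sets `O₁`, `O₂`,
the derivatives of order `i ≤ n` of `(x, y) ↦ (h₁ x, h₂ y)` at `q ∈ O₁ ×ˢ O₂` are bounded in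
norm by `max ‖Dⁱh₁ (q.1)‖ ‖Dⁱh₂ (q.2)‖` (`iteratedFDeriv_prodMk`, the norm of a product of
multilinear maps is the `max`, and the chain rule with `fst`, `snd`). [folklore] -/
private theorem norm_iteratedFDeriv_prodMap_le {O₁ : Set E₁} {O₂ : Set E₂} (hO₁ : IsOpen O₁)
    (hO₂ : IsOpen O₂) {n : ℕ} {h₁ : E₁ → W₁} {h₂ : E₂ → W₂} (hh₁ : ContDiffOn ℝ n h₁ O₁)
    (hh₂ : ContDiffOn ℝ n h₂ O₂) {q : E₁ × E₂} (hq : q ∈ O₁ ×ˢ O₂) {i : ℕ} (hi : i ≤ n) :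
    ‖iteratedFDeriv ℝ i (fun p : E₁ × E₂ ↦ (h₁ p.1, h₂ p.2)) q‖ ≤
      max ‖iteratedFDeriv ℝ i h₁ q.1‖ ‖iteratedFDeriv ℝ i h₂ q.2‖ := by
  have hc₁ : ContDiffAt ℝ n (fun p : E₁ × E₂ ↦ h₁ p.1) q :=
    (hh₁.contDiffAt (hO₁.mem_nhds hq.1)).comp q contDiffAt_fst
  have hc₂ : ContDiffAt ℝ n (fun p : E₁ × E₂ ↦ h₂ p.2) q :=
    (hh₂.contDiffAt (hO₂.mem_nhds hq.2)).comp q contDiffAt_snd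
  rw [iteratedFDeriv_prodMk hc₁ hc₂ (by exact_mod_cast hi), ContinuousMultilinearMap.opNorm_prod]
  refine max_le_max ?_ ?_
  · simpa using norm_iteratedFDeriv_clm_comp_comp_affine_le hO₁ hh₁
      (ContinuousLinearMap.fst ℝ E₁ E₂) 0 (ContinuousLinearMap.id ℝ W₁)
      (ContinuousLinearMap.norm_fst_le ℝ E₁ E₂) ContinuousLinearMap.norm_id_le (v := q)
      (by simpa using hq.1) hi
  · simpa using norm_iteratedFDeriv_clm_comp_comp_affine_le hO₂ hh₂
      (ContinuousLinearMap.snd ℝ E₁ E₂) 0 (ContinuousLinearMap.id ℝ W₂)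
      (ContinuousLinearMap.norm_snd_le ℝ E₁ E₂) ContinuousLinearMap.norm_id_le (v := q)
      (by simpa using hq.2) hi

/-- **First-component slices.** For `u` of class `Cᵏ` on an open `O ⊇ K ×ˢ {y₀}`, the `Cᵏ` sup
norm over `K` of the slice `x ↦ (u (x, y₀)).1` is at most that of `u` over `K ×ˢ {y₀}` (chain
rule with `inl` and `fst`, both of operator norm `≤ 1`). [folklore] -/
private theorem supCkENorm_slice_fst_le {O : Set (E₁ × E₂)} (hO : IsOpen O) {k : ℕ}
    {u : E₁ × E₂ → W₁ × W₂} (hu : ContDiffOn ℝ k u O) {K : Set E₁} {y₀ : E₂}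
    (hK : K ×ˢ {y₀} ⊆ O) :
    supCkENorm K k (fun x ↦ (u (x, y₀)).1) ≤ supCkENorm (K ×ˢ {y₀}) k u := by
  have h := supCkENorm_clm_comp_comp_affine_le hO hu (ContinuousLinearMap.inl ℝ E₁ E₂) (0, y₀)
    (ContinuousLinearMap.fst ℝ W₁ W₂) (ContinuousLinearMap.norm_inl_le_one ℝ E₁ E₂)
    (ContinuousLinearMap.norm_fst_le ℝ W₁ W₂) (K := K) (S := K ×ˢ {y₀})
    (fun x hx ↦ by simpa using hx) hK
  simpa using h

/-- **Second-component slices**: the `Cᵏ` sup norm over `K` of `y ↦ (u (x₀, y)).2` is at most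
that of `u` over `{x₀} ×ˢ K` (chain rule with `inr` and `snd`). [folklore] -/
private theorem supCkENorm_slice_snd_le {O : Set (E₁ × E₂)} (hO : IsOpen O) {k : ℕ}
    {u : E₁ × E₂ → W₁ × W₂} (hu : ContDiffOn ℝ k u O) {K : Set E₂} {x₀ : E₁}
    (hK : {x₀} ×ˢ K ⊆ O) :
    supCkENorm K k (fun y ↦ (u (x₀, y)).2) ≤ supCkENorm ({x₀} ×ˢ K) k u := by
  have h := supCkENorm_clm_comp_comp_affine_le hO hu (ContinuousLinearMap.inr ℝ E₁ E₂) (x₀, 0)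
    (ContinuousLinearMap.snd ℝ W₁ W₂) (ContinuousLinearMap.norm_inr_le_one ℝ E₁ E₂)
    (ContinuousLinearMap.norm_snd_le ℝ W₁ W₂) (K := K) (S := {x₀} ×ˢ K)
    (fun y hy ↦ by simpa using hy) hK
  simpa using h

/-- **Pointwise convergence from `Cᵏ` sup norm convergence**: if `supCkENorm K k (fᵢ − g) → 0`
then `fᵢ x → g x` at every `x ∈ K` (the order-zero term, `‖D⁰φ(x)‖ = ‖φ(x)‖`). [folklore] -/
private theorem tendsto_of_tendsto_supCkENorm_sub' {ι F W : Type*} {l : Filter ι}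
    [NormedAddCommGroup F] [NormedSpace ℝ F] [NormedAddCommGroup W] [NormedSpace ℝ W]
    {f : ι → F → W} {g : F → W} {K : Set F} {k : ℕ} {x : F} (hx : x ∈ K)
    (h : Tendsto (fun i ↦ supCkENorm K k (fun y ↦ f i y - g y)) l (𝓝 0)) :
    Tendsto (fun i ↦ f i x) l (𝓝 (g x)) := by
  -- adapted from `…OmegaLimitMultiKerrVacuumLimit` (`tendsto_of_tendsto_supCkENorm_sub`)
  rw [← tendsto_sub_nhds_zero_iff, tendsto_zero_iff_norm_tendsto_zero]
  have h0 : Tendsto (fun i ↦ iteratedFDeriv ℝ 0 (fun y ↦ f i y - g y) x) l (𝓝 0) :=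
    tendsto_zero_iff_enorm_tendsto_zero.2 (tendsto_of_tendsto_of_tendsto_of_le_of_le
      tendsto_const_nhds h (fun _ ↦ zero_le) fun i ↦
        enorm_iteratedFDeriv_le_supCkENorm (Nat.zero_le k) hx _)
  refine (tendsto_zero_iff_norm_tendsto_zero.1 h0).congr fun i ↦ ?_
  exact norm_iteratedFDeriv_zero

end TwoSystems

/-- **Registered structure stub (crux stmt-FinalStateConjecture-14664, line `Sketch`, stub
`JointUniformRecurrence`): two tame systems have jointly uniformly recurrent dark limits along a
common sequence of times.** Let `O₁ ⊆ E₁`, `O₂ ⊆ E₂` be nonempty, open and invariant under the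
translations by `e₁`, `e₂`, and `h₁`, `h₂` of class `C^{k+1}` on them and TAME along `e₁`, `e₂`
(derivatives of order `≤ k + 1` bounded at all late translates of every compact set). Then there
are `Cᵏ` fields `g₁` on `O₁`, `g₂` on `O₂` and ONE sequence `Tₙ → +∞` with
`supCkENorm K k (hⱼ (· + Tₙ • eⱼ) − gⱼ) → 0` on every compact `K ⊆ Oⱼ` (`j = 1, 2`), which are
JOINTLY UNIFORMLY RECURRENT: for all compact `K₁ ⊆ O₁`, `K₂ ⊆ O₂` and `ε > 0` there is `L > 0`
such that every interval `[t, t + L]` contains an `s` with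
`supCkENorm K₁ k (g₁ (· + s • e₁) − g₁) < ε` and `supCkENorm K₂ k (g₂ (· + s • e₂) − g₂) < ε`.
Proof: `exists_omegaLimit_uniformlyRecurrent` for the product field `(x, y) ↦ (h₁ x, h₂ y)` on
`O₁ ×ˢ O₂` with translation `(e₁, e₂)`, whose ω-limit is of product form (pointwise limits) and
controls its components through the slices `K₁ ×ˢ {y₀}`, `{x₀} ×ˢ K₂`. Birkhoff 1927, Ch. VII
§§1–2; Hale 1980, Ch. I §8. Closed form. [cite: Hale1980, Ch. I §8 Thm. 8.1] -/
theorem exists_joint_omegaLimit_uniformlyRecurrent :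
    ∀ {E₁ : Type*} [NormedAddCommGroup E₁] [NormedSpace ℝ E₁] [FiniteDimensional ℝ E₁]
      {E₂ : Type*} [NormedAddCommGroup E₂] [NormedSpace ℝ E₂] [FiniteDimensional ℝ E₂]
      {W₁ : Type*} [NormedAddCommGroup W₁] [NormedSpace ℝ W₁] [FiniteDimensional ℝ W₁]
      {W₂ : Type*} [NormedAddCommGroup W₂] [NormedSpace ℝ W₂] [FiniteDimensional ℝ W₂]
      {O₁ : Set E₁} {e₁ : E₁} {O₂ : Set E₂} {e₂ : E₂}, IsOpen O₁ → IsOpen O₂ →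
      O₁.Nonempty → O₂.Nonempty →
      (∀ x ∈ O₁, ∀ s : ℝ, x + s • e₁ ∈ O₁) → (∀ y ∈ O₂, ∀ s : ℝ, y + s • e₂ ∈ O₂) →
      ∀ {k : ℕ} {h₁ : E₁ → W₁} {h₂ : E₂ → W₂}, ContDiffOn ℝ (k + 1) h₁ O₁ →
      ContDiffOn ℝ (k + 1) h₂ O₂ →
      (∀ K ⊆ O₁, IsCompact K → ∃ Λ a : ℝ, ∀ t : ℝ, a ≤ t → ∀ i, i ≤ k + 1 → ∀ z ∈ K,
        ‖iteratedFDeriv ℝ i h₁ (z + t • e₁)‖ ≤ Λ) →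
      (∀ K ⊆ O₂, IsCompact K → ∃ Λ a : ℝ, ∀ t : ℝ, a ≤ t → ∀ i, i ≤ k + 1 → ∀ z ∈ K,
        ‖iteratedFDeriv ℝ i h₂ (z + t • e₂)‖ ≤ Λ) →
      ∃ (g₁ : E₁ → W₁) (g₂ : E₂ → W₂), ContDiffOn ℝ k g₁ O₁ ∧ ContDiffOn ℝ k g₂ O₂ ∧
        (∃ T : ℕ → ℝ, Tendsto T atTop atTop ∧
          (∀ K ⊆ O₁, IsCompact K →
            Tendsto (fun n ↦ supCkENorm K k (fun x ↦ h₁ (x + T n • e₁) - g₁ x)) atTop (𝓝 0)) ∧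
          (∀ K ⊆ O₂, IsCompact K →
            Tendsto (fun n ↦ supCkENorm K k (fun y ↦ h₂ (y + T n • e₂) - g₂ y)) atTop (𝓝 0))) ∧
        ∀ K₁ ⊆ O₁, IsCompact K₁ → ∀ K₂ ⊆ O₂, IsCompact K₂ → ∀ ε : ℝ, 0 < ε →
          ∃ L : ℝ, 0 < L ∧ ∀ t : ℝ, ∃ s ∈ Icc t (t + L),
            supCkENorm K₁ k (fun x ↦ g₁ (x + s • e₁) - g₁ x) < ENNReal.ofReal ε ∧
            supCkENorm K₂ k (fun y ↦ g₂ (y + s • e₂) - g₂ y) < ENNReal.ofReal ε := by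
  intro E₁ _ _ _ E₂ _ _ _ W₁ _ _ _ W₂ _ _ _ O₁ e₁ O₂ e₂ hO₁ hO₂ hne₁ hne₂ hO₁e hO₂e k h₁ h₂ hh₁ hh₂
    ht₁ ht₂
  obtain ⟨x₀, hx₀⟩ := hne₁
  obtain ⟨y₀, hy₀⟩ := hne₂
  -- (1) the product system `(x, y) ↦ (h₁ x, h₂ y)` on `O₁ ×ˢ O₂`, translation `(e₁, e₂)`
  have hO : IsOpen (O₁ ×ˢ O₂) := hO₁.prod hO₂
  have hOe : ∀ p ∈ O₁ ×ˢ O₂, ∀ s : ℝ, p + s • (e₁, e₂) ∈ O₁ ×ˢ O₂ := fun p hp s ↦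
    ⟨by simpa using hO₁e p.1 hp.1 s, by simpa using hO₂e p.2 hp.2 s⟩
  have hH : ContDiffOn ℝ (k + 1) (fun p : E₁ × E₂ ↦ (h₁ p.1, h₂ p.2)) (O₁ ×ˢ O₂) :=
    (hh₁.comp contDiffOn_fst fun p hp ↦ hp.1).prodMk (hh₂.comp contDiffOn_snd fun p hp ↦ hp.2)
  have htH : ∀ K ⊆ O₁ ×ˢ O₂, IsCompact K → ∃ Λ a : ℝ, ∀ t : ℝ, a ≤ t → ∀ i, i ≤ k + 1 →
      ∀ z ∈ K, ‖iteratedFDeriv ℝ i (fun p : E₁ × E₂ ↦ (h₁ p.1, h₂ p.2)) (z + t • (e₁, e₂))‖ ≤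
        Λ := by
    intro K hKO hK
    obtain ⟨Λ₁, a₁, hΛ₁⟩ := ht₁ (Prod.fst '' K) (image_subset_iff.2 fun p hp ↦ (hKO hp).1)
      (hK.image continuous_fst)
    obtain ⟨Λ₂, a₂, hΛ₂⟩ := ht₂ (Prod.snd '' K) (image_subset_iff.2 fun p hp ↦ (hKO hp).2)
      (hK.image continuous_snd)
    refine ⟨max Λ₁ Λ₂, max a₁ a₂, fun t ht i hi z hz ↦ ?_⟩
    refine (norm_iteratedFDeriv_prodMap_le hO₁ hO₂ hh₁ hh₂ (hOe z (hKO hz) t) hi).trans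
      (max_le_max ?_ ?_)
    · simpa using hΛ₁ t (le_of_max_le_left ht) i hi z.1 (mem_image_of_mem _ hz)
    · simpa using hΛ₂ t (le_of_max_le_right ht) i hi z.2 (mem_image_of_mem _ hz)
  -- (2) a uniformly recurrent ω-limit `G` of the product system
  obtain ⟨G, hG, ⟨T, hT, hlim⟩, hrec⟩ := exists_omegaLimit_uniformlyRecurrent hO hOe hH htH
  -- (3) pointwise limits: `G` is of product form on `O₁ ×ˢ O₂`
  have hpt : ∀ x ∈ O₁, ∀ y ∈ O₂, Tendsto (fun n ↦ h₁ (x + T n • e₁)) atTop (𝓝 (G (x, y)).1) ∧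
      Tendsto (fun n ↦ h₂ (y + T n • e₂)) atTop (𝓝 (G (x, y)).2) := by
    intro x hx y hy
    have h := tendsto_of_tendsto_supCkENorm_sub' (mem_singleton (x, y))
      (hlim {(x, y)} (singleton_subset_iff.2 ⟨hx, hy⟩) isCompact_singleton)
    exact ⟨by simpa using h.fst_nhds, by simpa using h.snd_nhds⟩
  have hG1 : ∀ x ∈ O₁, ∀ y ∈ O₂, ∀ y' ∈ O₂, (G (x, y)).1 = (G (x, y')).1 :=
    fun x hx y hy y' hy' ↦ tendsto_nhds_unique (hpt x hx y hy).1 (hpt x hx y' hy').1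
  have hG2 : ∀ x ∈ O₁, ∀ x' ∈ O₁, ∀ y ∈ O₂, (G (x, y)).2 = (G (x', y)).2 :=
    fun x hx x' hx' y hy ↦ tendsto_nhds_unique (hpt x hx y hy).2 (hpt x' hx' y hy).2
  -- (4) the components `g₁ = (G (·, y₀)).1`, `g₂ = (G (x₀, ·)).2`
  have hHk : ContDiffOn ℝ k (fun p : E₁ × E₂ ↦ (h₁ p.1, h₂ p.2)) (O₁ ×ˢ O₂) := hH.of_succ
  have hKy : ∀ K ⊆ O₁, K ×ˢ {y₀} ⊆ O₁ ×ˢ O₂ := fun K hK ↦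
    prod_mono hK (singleton_subset_iff.2 hy₀)
  have hKx : ∀ K ⊆ O₂, {x₀} ×ˢ K ⊆ O₁ ×ˢ O₂ := fun K hK ↦
    prod_mono (singleton_subset_iff.2 hx₀) hK
  have hg₁ : ContDiffOn ℝ k (fun x ↦ (G (x, y₀)).1) O₁ :=
    (hG.comp (contDiffOn_id.prodMk contDiffOn_const) fun x hx ↦ ⟨hx, hy₀⟩).fst
  have hg₂ : ContDiffOn ℝ k (fun y ↦ (G (x₀, y)).2) O₂ :=
    (hG.comp (contDiffOn_const.prodMk contDiffOn_id) fun y hy ↦ ⟨hx₀, hy⟩).snd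
  refine ⟨fun x ↦ (G (x, y₀)).1, fun y ↦ (G (x₀, y)).2, hg₁, hg₂,
    ⟨T, hT, fun K hK hKc ↦ ?_, fun K hK hKc ↦ ?_⟩, fun K₁ hK₁ hK₁c K₂ hK₂ hK₂c ε hε ↦ ?_⟩
  · -- convergence of the first components, read on the slice `K ×ˢ {y₀}`
    refine tendsto_of_tendsto_of_tendsto_of_le_of_le tendsto_const_nhds
      (hlim (K ×ˢ {y₀}) (hKy K hK) (hKc.prod isCompact_singleton)) (fun n ↦ zero_le) fun n ↦ ?_
    -- the two integrands agree definitionally (`((x, y₀) + Tₙ • (e₁, e₂)).1 = x + Tₙ • e₁`)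
    exact supCkENorm_slice_fst_le hO
      ((contDiffOn_comp_add_smul_of_forall_mem hOe hHk (T n)).sub hG) (hKy K hK)
  · -- convergence of the second components, read on the slice `{x₀} ×ˢ K`
    refine tendsto_of_tendsto_of_tendsto_of_le_of_le tendsto_const_nhds
      (hlim ({x₀} ×ˢ K) (hKx K hK) (isCompact_singleton.prod hKc)) (fun n ↦ zero_le) fun n ↦ ?_
    exact supCkENorm_slice_snd_le hO
      ((contDiffOn_comp_add_smul_of_forall_mem hOe hHk (T n)).sub hG) (hKx K hK)
  · -- (5) joint recurrence: the return times of `G` on `K₁ ×ˢ {y₀} ∪ {x₀} ×ˢ K₂`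
    obtain ⟨L, hL, hret⟩ := hrec (K₁ ×ˢ {y₀} ∪ {x₀} ×ˢ K₂)
      (union_subset (hKy K₁ hK₁) (hKx K₂ hK₂))
      ((hK₁c.prod isCompact_singleton).union (isCompact_singleton.prod hK₂c)) ε hε
    refine ⟨L, hL, fun t ↦ ?_⟩
    obtain ⟨s, hs, hsε⟩ := hret t
    have hv : ContDiffOn ℝ k (fun p : E₁ × E₂ ↦ G (p + s • (e₁, e₂)) - G p) (O₁ ×ˢ O₂) :=
      (contDiffOn_comp_add_smul_of_forall_mem hOe hG s).sub hG
    refine ⟨s, hs, ?_, ?_⟩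
    · calc supCkENorm K₁ k (fun x ↦ (G (x + s • e₁, y₀)).1 - (G (x, y₀)).1)
          = supCkENorm K₁ k
              (fun x ↦ ((fun p : E₁ × E₂ ↦ G (p + s • (e₁, e₂)) - G p) (x, y₀)).1) := by
            refine supCkENorm_congr fun x hx ↦ ?_
            filter_upwards [hO₁.mem_nhds (hK₁ hx)] with x' hx'
            simp only [Prod.smul_mk, Prod.mk_add_mk, Prod.fst_sub]
            rw [hG1 (x' + s • e₁) (hO₁e x' hx' s) (y₀ + s • e₂) (hO₂e y₀ hy₀ s) y₀ hy₀]
        _ ≤ supCkENorm (K₁ ×ˢ {y₀}) k (fun p : E₁ × E₂ ↦ G (p + s • (e₁, e₂)) - G p) :=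
            supCkENorm_slice_fst_le hO hv (hKy K₁ hK₁)
        _ ≤ supCkENorm (K₁ ×ˢ {y₀} ∪ {x₀} ×ˢ K₂) k
              (fun p : E₁ × E₂ ↦ G (p + s • (e₁, e₂)) - G p) :=
            supCkENorm_mono subset_union_left k _
        _ < ENNReal.ofReal ε := hsε
    · calc supCkENorm K₂ k (fun y ↦ (G (x₀, y + s • e₂)).2 - (G (x₀, y)).2)
          = supCkENorm K₂ k
              (fun y ↦ ((fun p : E₁ × E₂ ↦ G (p + s • (e₁, e₂)) - G p) (x₀, y)).2) := by
            refine supCkENorm_congr fun y hy ↦ ?_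
            filter_upwards [hO₂.mem_nhds (hK₂ hy)] with y' hy'
            simp only [Prod.smul_mk, Prod.mk_add_mk, Prod.snd_sub]
            rw [hG2 (x₀ + s • e₁) (hO₁e x₀ hx₀ s) x₀ hx₀ (y' + s • e₂) (hO₂e y' hy' s)]
        _ ≤ supCkENorm ({x₀} ×ˢ K₂) k (fun p : E₁ × E₂ ↦ G (p + s • (e₁, e₂)) - G p) :=
            supCkENorm_slice_snd_le hO hv (hKx K₂ hK₂)
        _ ≤ supCkENorm (K₁ ×ˢ {y₀} ∪ {x₀} ×ˢ K₂) k
              (fun p : E₁ × E₂ ↦ G (p + s • (e₁, e₂)) - G p) :=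
            supCkENorm_mono subset_union_right k _
        _ < ENNReal.ofReal ε := hsε

end Summit.FinalStateConjecture.FinalStateConjecture.Theorems.ClusterCompleteness

end
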